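import Literature.NumberTheory.Transcendental.KZProductIdeal
import Literature.NumberTheory.Transcendental.KZCalculusProofs
import Literature.NumberTheory.Transcendental.KZMellinFibres
import Literature.NumberTheory.Transcendental.KZSemiCanonicalReductionProofs
import Literature.NumberTheory.Transcendental.BoxIntegralZetaValues
import Literature.NumberTheory.Transcendental.KZBallPeelingAux
import HarnessLib

/-!
# Euler's reflection `ζ(2) = 2·Li₂(½) + log²2` BY THE MOVES, inside dimension 2 — part 1/4: the sets, the `ζ(2)` square `Zsq`, the shear chart `Φ(x,y) = (x,xy)` and MOVE 1 `[Zsq] ∼ [Ttri]`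

Theorems-split (≤ 400 lines each) of the decomp-kz lens-6 gen-4 file
`run/shared/lean/pub/decomp-kz/decomp-kz-lens-6/g4/RootDecompQuadraticDescentEulerReflection.lean` (1018 lines, critic re-check
2026-08-30T04:40:16Z: rc0, axioms(eulerReflection_byMoves) = {propext, Classical.choice, Quot.sound}); parts:
`…EulerShear` → `…EulerDissect` → `…EulerReflection` → `…EulerCensus`. Support for item stmt-KontsevichZagierPeriods-26540
(QuadraticDescent) and a decided ≥3-term dimension-2 instance for stmt-KontsevichZagierPeriods-4280.
Sources: Euler 1768; L. Lewin, *Polylogarithms and associated functions* (1981) §1.5; D. Zagier, *The dilogarithm function* (2007)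
§I.1–I.2; M. Kontsevich, D. Zagier, *Periods* (2001) §1.1, §1.2 (rules 1a, 1b, 2).
-/

noncomputable section

set_option linter.dupNamespace false

open MeasureTheory Set
open MvPolynomial (aeval X C)
open Literature.ModelTheory.ExponentialFields (IsSemialgebraic tarski_seidenberg_real_holds)

namespace Summit.KontsevichZagierPeriods.KontsevichZagierPeriods.Theorems.RootDecompQuadraticDescentEulerReflection

open Literature.NumberTheory.Transcendental
open Literature.NumberTheory.Transcendental.KZ

/-! ### The sets -/

/-- The open unit square. -/
def Sq : Set (Fin 2 → ℝ) := {z | ∀ j, z j ∈ Set.Ioo (0:ℝ) 1}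

/-- The open triangle `T = {0 < y < x < 1}` (coordinates `z 0 = x`, `z 1 = y`). -/
def T : Set (Fin 2 → ℝ) := {z | 0 < z 1 ∧ z 1 < z 0 ∧ z 0 < 1}

/-- `Sq` is `ℚ`-semialgebraic. [BCR1998 §2.2] -/
lemma isSemialgebraic_Sq : IsSemialgebraic ℚ Sq := KZ.isSemialgebraic_box 2

/-- `Sq` is measurable. [bookkeeping] -/
lemma measurableSet_Sq : MeasurableSet Sq := isSemialgebraic_Sq.measurableSet_holds

/-- `T` is `ℚ`-semialgebraic. [BCR1998 §2.2] -/
lemma isSemialgebraic_T : IsSemialgebraic ℚ T := by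
  have h := isSemialgebraic_setOf_forall_aeval_pos
    ![(X 1 : MvPolynomial (Fin 2) ℚ), X 0 - X 1, 1 - X 0]
  convert h using 1
  ext z
  simp only [T, mem_setOf_eq, Fin.forall_fin_succ, Matrix.cons_val_zero, Matrix.cons_val_succ, map_sub,
    map_one, MvPolynomial.aeval_X, sub_pos, IsEmpty.forall_iff, and_true]

/-! ### The `ζ(2)` square `Zsq = [(0,1)², dxdy/(1−xy)]` (tree: value `π²/6`) -/

/-- The integrand of `Zsq` as a function (polynomial quotient unfolded). [bookkeeping] -/
lemma Zsq_aux : (fun x : Fin 2 → ℝ => aeval x (1 : MvPolynomial (Fin 2) ℚ) / aeval x (1 - X 0 * X 1 : MvPolynomial (Fin 2) ℚ)) =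
    fun x => 1 / (1 - x 0 * x 1) := by
  funext x; simp

/-- `Zsq := [(0,1)², 1/(1 − xy)]`, KZ-rational. -/
def Zsq : KZ.IntegralRep 2 :=
  KZ.IntegralRep.ofRational Sq 1 (1 - X 0 * X 1) isSemialgebraic_Sq
    (fun x hx => by
      have h0 := hx 0; have h1 := hx 1
      have : x 0 * x 1 < 1 := by nlinarith [h0.1, h0.2, h1.1, h1.2]
      simp only [map_sub, map_one, map_mul, MvPolynomial.aeval_X]; exact (sub_pos.2 this).ne')
    (by rw [Zsq_aux]; exact box_integral_one_div_one_sub_mul_two.1)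

/-- `Zsq` is KZ-rational. [bookkeeping] -/
lemma isRational_Zsq : Zsq.IsRational := KZ.IntegralRep.isRational_ofRational _ _ _ _ _ _
/-- The domain of `Zsq`, by definition. [bookkeeping] -/
lemma domain_Zsq : Zsq.domain = Sq := rfl
/-- The integrand of `Zsq`, unfolded. [bookkeeping] -/
lemma integrand_Zsq : Zsq.integrand = fun x => 1 / (1 - x 0 * x 1) := by
  rw [Zsq, KZ.IntegralRep.integrand_ofRational, Zsq_aux]

/-- `value Zsq = ζ(2) = π²/6` (tree: `box_integral_one_div_one_sub_mul_two`). -/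
theorem value_Zsq : Zsq.value = Real.pi ^ 2 / 6 := by
  rw [KZ.IntegralRep.value, domain_Zsq, integrand_Zsq]
  exact box_integral_one_div_one_sub_mul_two.2

/-! ### The shear chart `Φ(x,y) = (x, xy)` : `(0,1)² → T`, `|det DΦ| = x` -/

/-- Auxiliary step `exists_shearChart`. [bookkeeping] -/
theorem exists_shearChart :
    ∃ (Φ : (Fin 2 → ℝ) → (Fin 2 → ℝ)) (Φ' : (Fin 2 → ℝ) → (Fin 2 → ℝ) →L[ℝ] (Fin 2 → ℝ)),
      (∀ z, Φ z 0 = z 0) ∧ (∀ z, Φ z 1 = z 0 * z 1) ∧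
      IsSemialgebraicMapOn ℚ Sq Φ ∧ (∀ z, HasFDerivAt Φ (Φ' z) z) ∧ Set.InjOn Φ Sq ∧ Φ '' Sq = T ∧
      (∀ z, (Φ' z).det = z 0) := by
  set Φ : (Fin 2 → ℝ) → (Fin 2 → ℝ) := fun z => ![z 0, z 0 * z 1] with hΦ
  set Φ' : (Fin 2 → ℝ) → (Fin 2 → ℝ) →L[ℝ] (Fin 2 → ℝ) :=
    fun z => LinearMap.toContinuousLinearMap (Matrix.toLin' !![1, 0; z 1, z 0]) with hΦ'
  have hΦ0 : ∀ z, Φ z 0 = z 0 := fun z => rfl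
  have hΦ1 : ∀ z, Φ z 1 = z 0 * z 1 := fun z => rfl
  have hΦ'0 : ∀ z v : Fin 2 → ℝ, Φ' z v 0 = v 0 := by
    intro z v
    change Matrix.toLin' !![1, 0; z 1, z 0] v 0 = _
    rw [Matrix.toLin'_apply]
    simp [Matrix.mulVec, dotProduct, Fin.sum_univ_two]
  have hΦ'1 : ∀ z v : Fin 2 → ℝ, Φ' z v 1 = z 1 * v 0 + z 0 * v 1 := by
    intro z v
    change Matrix.toLin' !![1, 0; z 1, z 0] v 1 = _
    rw [Matrix.toLin'_apply]
    simp [Matrix.mulVec, dotProduct, Fin.sum_univ_two]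
  have hdet : ∀ z, (Φ' z).det = z 0 := by
    intro z
    change LinearMap.det (Matrix.toLin' !![1, 0; z 1, z 0]) = _
    rw [LinearMap.det_toLin', Matrix.det_fin_two]
    simp
  have hderiv : ∀ z, HasFDerivAt Φ (Φ' z) z := by
    intro z
    have h0 : HasFDerivAt (fun y : Fin 2 → ℝ => y 0)
        (ContinuousLinearMap.proj (R := ℝ) (φ := fun _ : Fin 2 => ℝ) 0) z := hasFDerivAt_apply 0 z
    have h1 : HasFDerivAt (fun y : Fin 2 → ℝ => y 1)
        (ContinuousLinearMap.proj (R := ℝ) (φ := fun _ : Fin 2 => ℝ) 1) z := hasFDerivAt_apply 1 z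
    rw [hasFDerivAt_pi']
    refine Fin.forall_fin_two.mpr ⟨?_, ?_⟩
    · have hf : (fun y : Fin 2 → ℝ => Φ y 0) = fun y => y 0 := funext fun y => rfl
      rw [hf]
      refine h0.congr_fderiv (ContinuousLinearMap.ext fun v => ?_)
      simp [hΦ'0]
    · have hf : (fun y : Fin 2 → ℝ => Φ y 1) = fun y => y 0 * y 1 := funext fun y => rfl
      rw [hf]
      refine (h0.mul h1).congr_fderiv (ContinuousLinearMap.ext fun v => ?_)
      simp [hΦ'1]
      ring
  refine ⟨Φ, Φ', hΦ0, hΦ1, ?_, hderiv, ?_, ?_, hdet⟩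
  · convert isSemialgebraicMapOn_aeval isSemialgebraic_Sq
      ![(MvPolynomial.X 0 : MvPolynomial (Fin 2) ℚ), MvPolynomial.X 0 * MvPolynomial.X 1] using 2 with z
    funext i
    fin_cases i
    · simp [hΦ0]
    · simp [hΦ1]
  · intro x hx y hy hxy
    have e0 := congrFun hxy 0
    have e1 := congrFun hxy 1
    simp only [hΦ0, hΦ1] at e0 e1
    have h1 : x 1 = y 1 := by
      rw [e0] at e1
      exact mul_left_cancel₀ (hy 0).1.ne' e1
    funext i
    fin_cases i
    · exact e0
    · exact h1
  · ext y
    constructor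
    · rintro ⟨z, hz, rfl⟩
      have h0 := hz 0; have h1 := hz 1
      simp only [T, mem_setOf_eq, hΦ0, hΦ1]
      refine ⟨mul_pos h0.1 h1.1, ?_, h0.2⟩
      nlinarith [h0.1, h1.2]
    · rintro ⟨hy0, hy1, hy2⟩
      have hx : 0 < y 0 := lt_trans hy0 hy1
      refine ⟨![y 0, y 1 / y 0], ?_, ?_⟩
      · intro j
        fin_cases j
        · exact ⟨hx, hy2⟩
        · change y 1 / y 0 ∈ Set.Ioo (0:ℝ) 1
          exact ⟨div_pos hy0 hx, by rw [div_lt_one hx]; exact hy1⟩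
      · funext i
        fin_cases i
        · rfl
        · change y 0 * (y 1 / y 0) = y 1
          field_simp

/-! ### The triangle representation `Ttri = [T, dxdy/((1−y)x)]` and move 1 -/

/-- The integrand of `f` as a function (polynomial quotient unfolded). [bookkeeping] -/
lemma f_aux : (fun x : Fin 2 → ℝ => aeval x (1 : MvPolynomial (Fin 2) ℚ) / aeval x ((1 - X 1) * X 0 : MvPolynomial (Fin 2) ℚ)) =
    fun x => 1 / ((1 - x 1) * x 0) := by
  funext x; simp

/-- Auxiliary step `den_ne_zero_of_mem_T`. [bookkeeping] -/
lemma den_ne_zero_of_mem_T {x : Fin 2 → ℝ} (hx : x ∈ T) : (1 - x 1) * x 0 ≠ 0 := by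
  obtain ⟨h0, h1, h2⟩ := hx
  exact mul_ne_zero (by linarith) (by linarith)

/-- Integrability of `1/((1−y)x)` on `T`, transported from `Zsq` through the shear chart. -/
lemma integrableOn_f_T : IntegrableOn (fun x : Fin 2 → ℝ => 1 / ((1 - x 1) * x 0)) T := by
  obtain ⟨Φ, Φ', hΦ0, hΦ1, -, hderiv, hinj, himage, hdet⟩ := exists_shearChart
  rw [← himage, integrableOn_image_iff_integrableOn_abs_det_fderiv_smul volume measurableSet_Sq
    (fun z _ => (hderiv z).hasFDerivWithinAt) hinj]
  refine (box_integral_one_div_one_sub_mul_two.1).congr_fun (fun z hz => ?_) measurableSet_Sq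
  have h0 := hz 0; have h1 := hz 1
  have hx : (0:ℝ) < z 0 := h0.1
  have hxy : z 0 * z 1 < 1 := by nlinarith [h0.1, h0.2, h1.1, h1.2]
  simp only [hdet, hΦ0, hΦ1, smul_eq_mul, abs_of_pos hx]
  field_simp

/-- `Ttri := [T, 1/((1−y)x)]`, KZ-rational (the classical `ζ(2)` triangle). -/
def Ttri : KZ.IntegralRep 2 :=
  KZ.IntegralRep.ofRational T 1 ((1 - X 1) * X 0) isSemialgebraic_T
    (fun x hx => by simpa using den_ne_zero_of_mem_T hx)
    (by rw [f_aux]; exact integrableOn_f_T)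

/-- The domain of `Ttri`, by definition. [bookkeeping] -/
lemma domain_Ttri : Ttri.domain = T := rfl
/-- The integrand of `Ttri`, unfolded. [bookkeeping] -/
lemma integrand_Ttri : Ttri.integrand = fun x => 1 / ((1 - x 1) * x 0) := by
  rw [Ttri, KZ.IntegralRep.integrand_ofRational, f_aux]

/-- MOVE 1 (rule 2, the shear `(x,y) ↦ (x,xy)`): `[Zsq] − [Ttri] ∈ KZ.relations`. -/
theorem Zsq_sub_Ttri_mem : of Zsq - of Ttri ∈ KZ.relations := by
  obtain ⟨Φ, Φ', hΦ0, hΦ1, hsa, hderiv, hinj, himage, hdet⟩ := exists_shearChart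
  refine changeOfVariablesRel_subset_relations ⟨2, Zsq, Ttri, Φ, Φ', hsa,
    fun z _ => (hderiv z).hasFDerivWithinAt, hinj, himage.symm, fun z hz => ?_, rfl⟩
  have h0 := hz 0; have h1 := hz 1
  have hx : (0:ℝ) < z 0 := h0.1
  have hxy : z 0 * z 1 < 1 := by nlinarith [h0.1, h0.2, h1.1, h1.2]
  rw [integrand_Zsq, integrand_Ttri]
  simp only [hdet, hΦ0, hΦ1, abs_of_pos hx]
  field_simp

end Summit.KontsevichZagierPeriods.KontsevichZagierPeriods.Theorems.RootDecompQuadraticDescentEulerReflection
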